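/-
Copyright (c) 2026 the pub-hodgecm-mathlib formalisation cell (harness21).  Prover seat hodgecm-mathlib-K2Liu-p07 (g2): Track B «K2-LIT»,
#184♮ = hLiu418 = stmt-HodgeConjecture-24832; LEAD F0P6-plan (g10) DEAL∕SWAP 2026-09-03T23:05:23Z «O41.4» (organ of socket #41
`sig_K2LiuSiegelEisensteinContinuation`); REPORT-FIRST O41.4 99eb0f16d8bad5ea, file (c); 2026-09-03.
-/
import Summits.HodgeConjecture.HodgeConjecture.Theorems.K2LiuConstantTermBigCellUnfold
import Literature.MeasureTheory.Group.CoveringWeightsBochner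
import HarnessLib

/-!
# Crux `HLiu418`, road `K2_Liu`, organ O41.4 file (c): THE CONSTANT TERM OF THE SIEGEL EISENSTEIN SERIES ALONG `N_Δ` — THREE CELLS
# `CT_β(E f)(h) = vol_β · f(h) + M(s)f(h) + MID(f)(h)` (Bochner identity, covering-weight currency)

Cell `hodgecm-mathlib`, crux item hLiu418 = `stmt-HodgeConjecture-24832`, route `HCCMUnconditional`; squad K2 ∕ K2Liu, LEAD F0P6-plan (g10),
planner K2Liu-plan (g0), #41 steward lineage K2Liu-p01, prover K2Liu-p07 (g2).  THEOREMS ONLY (no `def`, no instance, no notation, no named-fact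
hypothesis, no `sorry`); lane `--supports stmt-HodgeConjecture-24832` (count-neutral helper).

THE STATEMENT (REPORT-FIRST O41.4 «ORBIT FORM», v1).  Setting of ★ file (b) `K2LiuConstantTermBigCellUnfold`: `N_Δ(𝔸) = ↥unipDelta` with Borel
structure and a left-invariant (Haar) measure `νN`; `β` an `N_Δ(L⁺)`-covering weight (a weighted fundamental domain of the compact `N_Δ(L⁺)\N_Δ(𝔸)`;
produced, with compact support and finite mass, by ★ `K2LiuUnipotentCoveringWeight.exists_isCoveringWeight_unipDeltaRat_lintegral_ne_top`, K2Liu-p06 —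
finite mass is NOT needed below: if `∫⁻ β = ∞` then (H) forces `f(h) = 0` and the identity cell reads `0`); `f` a continuous Siegel
section of `I_Δ(s,χ)`; `E(x) = eisensteinSeriesDelta f x = Σ'_q f(γ_q x)`; `w_Δ` presented rationally by `wq ν = w_Δ ν`; `0 < n`; and the ANALYTIC BINDER
  (H)  `∫⁻ (Σ'_q ‖f(γ_q u h)‖ₑ) β(u) dνN(u) ≠ ∞`
(the majorant series is integrable over one weighted fundamental domain; holds for `Re s > n/2` by socket #9 + local uniformity — K2Liu-p06's (M3)).
THEN (**`constTerm_three_cells`**):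
  `∫ β(u) • E(u h) dνN(u) = (∫ β dνN) • f(h) + intertwiningDelta νN f h + ∫ β(u) • (Σ'_{q ∈ REST} f(γ_q u h)) dνN(u)`,
`REST = P_Δ(L⁺)\H(L⁺) ∖ ({[1]} ∪ [w_Δ N_Δ(L⁺)])` — i.e. **`E_{P_Δ}(h; f_s) = vol · f_s(h) + M(s)f_s(h) + E₁(s)(h)`** with the middle term `E₁` carried as
the explicit sum over the remaining `N_Δ(L⁺)`-orbits (for `n = 2`: the cosets inside the single rank-1 double coset `P_Δ w₁ P_Δ`, indexed by
`B(L)\GL₂(L)`; their sum is the `GL₂(𝔸_L)`-Borel Eisenstein series of the `w₁`-intertwined section — an identification left to O41.8, NOT claimed here).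
The left side is the constant term along `N_Δ` in covering-weight currency: `∫_{N(L⁺)\N(𝔸)} E(u h) du` read as `∫_{N(𝔸)} β(u) E(u h) dνN(u)`, which
for the left-`N_Δ(L⁺)`-invariant `u ↦ E(u h)` does not depend on `β` (★ `integral_wt_smul_eq_of_coveringSum_eq_one`) and is `vol_β · constTermDelta ν`
for the invariant probability `ν` on ★ `UnipDeltaQuot` (Weil; that one-line bridge to ★ D9's spelling is owed to the socket's typist).
PROOF.  Fubini for series under (H) (Mathlib `integral_tsum`) makes `∫ β • E(·h) = Σ'_q ∫ β • f(γ_q · h)`, an absolutely convergent series; split it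
along `{[1]} ⊔ [w_Δ N_Δ(L⁺)] ⊔ REST` (★ (b): the orbit map is injective and misses `[1]`); the `[1]`-term is `(∫β)·f(h)` (★ (b) `apply_out_mk_one_mul`, ★ D9
`apply_unipDelta_mul`); the `w_Δ`-terms re-sum (Fubini backwards, finiteness ★ (b) `three_cells_ne_top`) to `∫ β(u) • Σ'_ν f(w_Δ ν u h)`, which is
`∫ f(w_Δ u h) dνN = intertwiningDelta νN f h` by the Bochner unfolding of the free orbit (★ `integral_wt_smul_eq_integral_wt_smul_tsum`, `Γ' = 1`).
[MoeglinWaldspurger1995, II.1.7], [KudlaRallis1994, §2 (2.x)], [Tan1999, §2], [GelbartPiatetskishapiroRallis1987, Part A §§1–2], [Garrett2018, §3.10].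
HONEST LABEL.  Count-neutral helper; `HC_CM` is proved only modulo the 7 printed citations (2 remaining named inputs: hLiu418 =
`stmt-HodgeConjecture-24832`, h413 = `stmt-HodgeConjecture-24833`) until rung 0 closes.
-/

set_option autoImplicit false
set_option linter.dupNamespace false -- the mandated namespace repeats `HodgeConjecture.HodgeConjecture`

noncomputable section

open scoped Matrix ENNReal NNReal
open NumberField IsDedekindDomain MeasureTheory MeasureTheory.Measure Filter Set Function
open Literature.NumberTheory.Automorphic Literature.NumberTheory.GaloisRepresentations
open Literature.NumberTheory.GelbartRogawski1991 Literature.NumberTheory.GelbartRogawski1991.GRConstruction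
open Literature.NumberTheory.K2Lit.SiegelDoubled Literature.MeasureTheory.Group

namespace Summit.HodgeConjecture.HodgeConjecture.Cruxes.HLiu418.K2LiuConstantTermDelta

open K2LiuSiegelBigCellFree K2LiuSiegelEisensteinDoubledLeftInvariant K2LiuSiegelDoubledUnfold K2LiuUnipotentCoveringWeight
  K2LiuConstantTermBigCellUnfold

variable {L : Type} [Field L] [NumberField L] [IsCMField L]
variable {N M n : ℕ} {e : Fin N × Fin M ≃ Fin n}
  {dV : Fin N → L} {hdV : ∀ i, IsCMField.complexConj L (dV i) = dV i}
  {dW : Fin M → L} {hdW : ∀ i, IsCMField.complexConj L (dW i) = dW i}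
variable [MeasurableSpace (unipDelta L e dV hdV dW hdW)] [BorelSpace (unipDelta L e dV hdV dW hdW)]

/-! ## §1 Measurability and the `L¹`-size of the weighted summands -/

/-- the weighted summand `u ↦ β(u) • f(a (u h))` is a.e.-strongly measurable (`β` measurable, `f` continuous). [folklore] -/
theorem aestronglyMeasurable_wt_smul_apply (νN : Measure (unipDelta L e dV hdV dW hdW)) {β : unipDelta L e dV hdV dW hdW → ℝ≥0∞}
    (hβm : Measurable β) {f : HA L e dV hdV dW hdW → ℂ} (hfc : Continuous f) (a h : HA L e dV hdV dW hdW) :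
    AEStronglyMeasurable (fun u : unipDelta L e dV hdV dW hdW => (β u).toReal • f (a * ((u : HA L e dV hdV dW hdW) * h))) νN :=
  (hβm.ennreal_toReal.smul (hfc.comp (continuous_const.mul (continuous_subtype_val.mul continuous_const))).measurable).aestronglyMeasurable

omit [BorelSpace (unipDelta L e dV hdV dW hdW)] in
/-- `‖β(u) • z‖ₑ = ‖z‖ₑ · β(u)` for a covering weight (`β ≤ 1 < ∞`). [folklore] -/
theorem enorm_wt_smul {β : unipDelta L e dV hdV dW hdW → ℝ≥0∞} (hβ : IsCoveringWeight (unipDeltaRat L e dV hdV dW hdW) β)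
    (u : unipDelta L e dV hdV dW hdW) (z : ℂ) : ‖(β u).toReal • z‖ₑ = ‖z‖ₑ * β u := by
  have hfin : β u ≠ ∞ := ne_top_of_le_ne_top ENNReal.one_ne_top (hβ.le_one u)
  rw [enorm_smul, Real.enorm_eq_ofReal ENNReal.toReal_nonneg, ENNReal.ofReal_toReal hfin, mul_comm]

/-! ## §2 The Bochner unfolding of the free `w_Δ`-orbit -/

/-- **`∫ β(u) • Σ'_ν f(w_Δ ν u h) dνN = ∫ f(w_Δ u h) dνN = intertwiningDelta νN f h`** as soon as `u ↦ f(w_Δ u h)` is `νN`-integrable in norm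
(`∫⁻ ‖f(w_Δ u h)‖ₑ dνN < ∞`) — the Bochner unfolding of the free orbit (★ `integral_wt_smul_eq_integral_wt_smul_tsum`, `Γ' = 1`).
[cite: Garrett2018, §3.10] [cite: MoeglinWaldspurger1995, II.1.7] -/
theorem integral_wt_smul_tsum_weylDelta_orbit (νN : Measure (unipDelta L e dV hdV dW hdW)) [νN.IsMulLeftInvariant]
    {β : unipDelta L e dV hdV dW hdW → ℝ≥0∞} (hβ : IsCoveringWeight (unipDeltaRat L e dV hdV dW hdW) β)
    {f : HA L e dV hdV dW hdW → ℂ} (hfc : Continuous f) (h : HA L e dV hdV dW hdW)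
    (hint : ∫⁻ u, ‖f (weylDelta L e dV hdV dW hdW * (u : HA L e dV hdV dW hdW) * h)‖ₑ ∂νN ≠ ∞) :
    ∫ u, (β u).toReal • (∑' ν : unipDeltaRat L e dV hdV dW hdW,
        f (weylDelta L e dV hdV dW hdW * ((ν : unipDelta L e dV hdV dW hdW) : HA L e dV hdV dW hdW) * ((u : HA L e dV hdV dW hdW) * h))) ∂νN =
      intertwiningDelta L e dV hdV dW hdW νN f h := by
  haveI : Countable (unipDeltaRat L e dV hdV dW hdW) := countable_unipDeltaRat L e dV hdV dW hdW
  haveI : MeasurableConstSMul (unipDelta L e dV hdV dW hdW) (unipDelta L e dV hdV dW hdW) := ⟨fun g => measurable_const_mul g⟩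
  haveI : SMulInvariantMeasure (unipDelta L e dV hdV dW hdW) (unipDelta L e dV hdV dW hdW) νN :=
    ⟨fun g s _hs => by rw [show (fun x : unipDelta L e dV hdV dW hdW => g • x) ⁻¹' s = (fun x => g * x) ⁻¹' s from rfl, measure_preimage_mul]⟩
  set F : unipDelta L e dV hdV dW hdW → ℂ := fun u => f (weylDelta L e dV hdV dW hdW * (u : HA L e dV hdV dW hdW) * h) with hF
  have hFm : StronglyMeasurable F := (hfc.comp ((continuous_const.mul continuous_subtype_val).mul continuous_const)).stronglyMeasurable
  have h1w : ∀ x : unipDelta L e dV hdV dW hdW, coveringSum (⊥ : Subgroup (unipDelta L e dV hdV dW hdW)) (fun _ => (1 : ℝ≥0∞)) x = 1 := by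
    intro x
    rw [coveringSum_apply, tsum_eq_single (1 : (⊥ : Subgroup (unipDelta L e dV hdV dW hdW))) (fun b hb => absurd (Subsingleton.elim b 1) hb)]
  have hs : ∀ γ ∈ unipDeltaRat L e dV hdV dW hdW, ∃! i : unipDeltaRat L e dV hdV dW hdW,
      γ * ((i : unipDelta L e dV hdV dW hdW))⁻¹ ∈ (⊥ : Subgroup (unipDelta L e dV hdV dW hdW)) := by
    intro γ hγ
    refine ⟨⟨γ, hγ⟩, by simp, fun i hi => ?_⟩
    have hi' : γ * ((i : unipDelta L e dV hdV dW hdW))⁻¹ ∈ (⊥ : Subgroup (unipDelta L e dV hdV dW hdW)) := hi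
    rw [Subgroup.mem_bot, mul_inv_eq_one] at hi'
    exact Subtype.ext hi'.symm
  have key := integral_wt_smul_eq_integral_wt_smul_tsum νN (unipDeltaRat L e dV hdV dW hdW) ⊥ bot_le (F := F) hFm
    (fun γ hγ x => by rw [Subgroup.mem_bot] at hγ; rw [hγ, one_smul]) (β' := fun _ => 1) (β := β) measurable_const h1w hβ.1 hβ.2
    (s := fun i : unipDeltaRat L e dV hdV dW hdW => (i : unipDelta L e dV hdV dW hdW)) (fun i => i.2) hs
    (by simp only [mul_one]; exact lt_top_iff_ne_top.2 hint)
  have hwt1 : ∀ x : unipDelta L e dV hdV dW hdW, wt (fun _ => (1 : ℝ≥0∞)) x • F x = F x := fun x => by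
    simp [wt]
  simp_rw [hwt1] at key
  -- `key : ∫ F = ∫ wt β • Σ'_i F(i • x)`; our integrand is the same series up to re-association
  unfold intertwiningDelta
  rw [show (∫ u, f (weylDelta L e dV hdV dW hdW * (u : HA L e dV hdV dW hdW) * h) ∂νN) = ∫ u, F u ∂νN from rfl, key]
  refine integral_congr_ae (ae_of_all _ fun u => ?_)
  show (β u).toReal • _ = wt β u • _
  congr 1
  refine tsum_congr fun ν => ?_
  rw [hF]
  simp only [smul_eq_mul, Subgroup.coe_mul, mul_assoc]

/-! ## §3 THE CONSTANT TERM ALONG `N_Δ`: three cells -/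

section Main

variable (wq : unipDeltaRat L e dV hdV dW hdW → ratH L e dV hdV dW hdW)
  (hwq : ∀ ν, ((wq ν : ratH L e dV hdV dW hdW) : HA L e dV hdV dW hdW) =
    weylDelta L e dV hdV dW hdW * ((ν : unipDelta L e dV hdV dW hdW) : HA L e dV hdV dW hdW))

set_option maxHeartbeats 400000 in
include hwq in
/-- **O41.4 (v1, «ORBIT FORM») — THE CONSTANT TERM OF THE SIEGEL EISENSTEIN SERIES ALONG `N_Δ` SPLITS INTO THREE CELLS:**
  `∫ β(u) • E(u h; f) dνN(u) = (∫ β dνN) • f(h) + intertwiningDelta νN f h + ∫ β(u) • (Σ'_{q ∈ REST} f(γ_q u h)) dνN(u)`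
for a continuous Siegel section `f` of `I_Δ(s, χ)`, a left-invariant measure `νN` on `N_Δ(𝔸)`, an `N_Δ(L⁺)`-covering weight `β`, `0 < n`,
under the analytic binder (H) `∫⁻ (Σ'_q ‖f(γ_q u h)‖ₑ) β dνN ≠ ∞`.  Here `E = ` ★ `eisensteinSeriesDelta f`, `γ_q = Quotient.out q`, the `w_Δ`-orbit
is presented by `wq ν = w_Δ ν ∈ H(L⁺)`, and `REST` is the complement of `{[1]} ∪ {[w_Δ ν]}` in `P_Δ(L⁺)\H(L⁺)` — identity cell `vol · f(h)`,
big cell `M(s)f(h)` (the FULL intertwining integral, because the big cell is free: ★ (a)), and the middle cosets carried verbatim (`= E₁(s)(h)`, the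
`GL₂(𝔸_L)`-Borel Eisenstein term for `n = 2`, identified in a later organ).  All three terms are absolutely convergent Bochner integrals under (H)
(★ (b) `three_cells_ne_top`). [cite: MoeglinWaldspurger1995, II.1.7] [cite: KudlaRallis1994, §2] [cite: Tan1999, §2]
[cite: GelbartPiatetskishapiroRallis1987, Part A §2] [cite: Garrett2018, §3.10] -/
theorem constTerm_three_cells (hn : 0 < n) (νN : Measure (unipDelta L e dV hdV dW hdW)) [νN.IsMulLeftInvariant]
    {β : unipDelta L e dV hdV dW hdW → ℝ≥0∞} (hβ : IsCoveringWeight (unipDeltaRat L e dV hdV dW hdW) β)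
    {χ : HeckeCharacter L} {s : ℂ} {f : HA L e dV hdV dW hdW → ℂ} (hf : IsSiegelDeltaSection L e dV hdV dW hdW χ s f) (hfc : Continuous f)
    (h : HA L e dV hdV dW hdW)
    (hH : ∫⁻ u, (∑' q : SiegelDeltaQuot L e dV hdV dW hdW,
        ‖f ((((Quotient.out q : ratH L e dV hdV dW hdW) : HA L e dV hdV dW hdW)) * ((u : HA L e dV hdV dW hdW) * h))‖ₑ) * β u ∂νN ≠ ∞) :
    ∫ u, (β u).toReal • eisensteinSeriesDelta L e dV hdV dW hdW f ((u : HA L e dV hdV dW hdW) * h) ∂νN =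
      (∫ u, (β u).toReal ∂νN) • f h + intertwiningDelta L e dV hdV dW hdW νN f h +
        ∫ u, (β u).toReal • (∑' q : ↥(({Quotient.mk (MulAction.orbitRel (siegelDeltaRat L e dV hdV dW hdW) (ratH L e dV hdV dW hdW)) 1} ∪
            Set.range (fun ν : unipDeltaRat L e dV hdV dW hdW =>
              (Quotient.mk (MulAction.orbitRel (siegelDeltaRat L e dV hdV dW hdW) (ratH L e dV hdV dW hdW)) (wq ν) :
                SiegelDeltaQuot L e dV hdV dW hdW)))ᶜ : Set (SiegelDeltaQuot L e dV hdV dW hdW)),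
          f ((((Quotient.out (q : SiegelDeltaQuot L e dV hdV dW hdW) : ratH L e dV hdV dW hdW) : HA L e dV hdV dW hdW)) *
            ((u : HA L e dV hdV dW hdW) * h))) ∂νN := by
  haveI : Countable (unipDeltaRat L e dV hdV dW hdW) := countable_unipDeltaRat L e dV hdV dW hdW
  haveI : Countable (ratH L e dV hdV dW hdW) := countable_ratH L e dV hdV dW hdW
  haveI : Countable (SiegelDeltaQuot L e dV hdV dW hdW) := by unfold SiegelDeltaQuot; exact inferInstance
  -- notation (as in ★ (b))
  set q₁ : SiegelDeltaQuot L e dV hdV dW hdW :=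
    Quotient.mk (MulAction.orbitRel (siegelDeltaRat L e dV hdV dW hdW) (ratH L e dV hdV dW hdW)) 1 with hq₁
  set qw : unipDeltaRat L e dV hdV dW hdW → SiegelDeltaQuot L e dV hdV dW hdW := fun ν =>
    (Quotient.mk (MulAction.orbitRel (siegelDeltaRat L e dV hdV dW hdW) (ratH L e dV hdV dW hdW)) (wq ν) :
      SiegelDeltaQuot L e dV hdV dW hdW) with hqw
  set Fq : SiegelDeltaQuot L e dV hdV dW hdW → unipDelta L e dV hdV dW hdW → ℂ := fun q u =>
    f ((((Quotient.out q : ratH L e dV hdV dW hdW) : HA L e dV hdV dW hdW)) * ((u : HA L e dV hdV dW hdW) * h)) with hFq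
  set g : SiegelDeltaQuot L e dV hdV dW hdW → unipDelta L e dV hdV dW hdW → ℂ := fun q u => (β u).toReal • Fq q u with hg
  have hgm : ∀ q, AEStronglyMeasurable (g q) νN := fun q => aestronglyMeasurable_wt_smul_apply νN hβ.1 hfc _ h
  have hFqm : ∀ q, Measurable fun u => ‖Fq q u‖ₑ := fun q => measurable_enorm_apply_mul_coe_mul' hfc _ h
  have hgn : ∀ q u, ‖g q u‖ₑ = ‖Fq q u‖ₑ * β u := fun q u => enorm_wt_smul hβ u _
  -- the three finiteness statements of ★ (b)
  obtain ⟨-, hfin2, hfin3⟩ := three_cells_ne_top wq hwq hn νN hβ hf hfc h hH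
  -- Step 1: Fubini for series under (H): `∫ β • E(·h) = Σ'_q ∫ g q`
  have hsum : ∑' q, ∫⁻ u, ‖g q u‖ₑ ∂νN ≠ ∞ := by
    simp_rw [hgn]
    rw [← lintegral_tsum (f := fun q u => ‖Fq q u‖ₑ * β u) fun q => ((hFqm q).mul hβ.1).aemeasurable]
    simp_rw [ENNReal.tsum_mul_right]
    exact hH
  have h1 : ∫ u, (β u).toReal • eisensteinSeriesDelta L e dV hdV dW hdW f ((u : HA L e dV hdV dW hdW) * h) ∂νN = ∑' q, ∫ u, g q u ∂νN := by
    rw [← integral_tsum hgm hsum]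
    refine integral_congr_ae (ae_of_all _ fun u => ?_)
    show (β u).toReal • eisensteinSeriesDelta L e dV hdV dW hdW f ((u : HA L e dV hdV dW hdW) * h) = ∑' q, (β u).toReal • Fq q u
    rw [tsum_const_smul'' (β u).toReal]
    rfl
  -- Step 2: the series `q ↦ J q = ∫ g q` is absolutely summable; split it along `{q₁} ⊔ range qw ⊔ REST`
  set J : SiegelDeltaQuot L e dV hdV dW hdW → ℂ := fun q => ∫ u, g q u ∂νN with hJ
  have hJs : Summable J := by
    refine Summable.of_norm_bounded (ENNReal.summable_toReal hsum) fun q => ?_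
    rw [← toReal_enorm (J q)]
    exact ENNReal.toReal_mono (ENNReal.ne_top_of_tsum_ne_top hsum q) (enorm_integral_le_lintegral_enorm _)
  have hdisj : Disjoint ({q₁} : Set (SiegelDeltaQuot L e dV hdV dW hdW)) (Set.range qw) := by
    rw [Set.disjoint_singleton_left]
    rintro ⟨ν, hν⟩
    exact mk_wq_ne_mk_one wq hwq hn ν hν
  have hB : ∑' q, J q = J q₁ + ∑' ν, J (qw ν) + ∑' q : ↥(({q₁} ∪ Set.range qw)ᶜ : Set (SiegelDeltaQuot L e dV hdV dW hdW)), J q := by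
    rw [← (hJs.subtype _).tsum_add_tsum_compl (hJs.subtype (({q₁} ∪ Set.range qw)ᶜ : Set (SiegelDeltaQuot L e dV hdV dW hdW))),
      (hJs.subtype _).tsum_union_disjoint hdisj (hJs.subtype _), tsum_singleton, tsum_range J (mk_wq_injective wq hwq)]
  -- Step 3a: the identity cell
  have hC : J q₁ = (∫ u, (β u).toReal ∂νN) • f h := by
    have h1' : ∀ u : unipDelta L e dV hdV dW hdW, g q₁ u = (β u).toReal • f h := fun u => by
      rw [hg, hFq]
      dsimp only
      rw [hq₁, apply_out_mk_one_mul hf, apply_unipDelta_mul hf u.2 h]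
    show (∫ u, g q₁ u ∂νN) = _
    simp_rw [h1']
    exact integral_smul_const _ (f h)
  -- Step 3b: the free `w_Δ`-cell re-sums to the intertwining integral
  have hD : ∑' ν, J (qw ν) = intertwiningDelta L e dV hdV dW hdW νN f h := by
    have hsum2 : ∑' ν, ∫⁻ u, ‖g (qw ν) u‖ₑ ∂νN ≠ ∞ := by
      simp_rw [hgn]
      rw [← lintegral_tsum (f := fun ν u => ‖Fq (qw ν) u‖ₑ * β u) fun ν => ((hFqm (qw ν)).mul hβ.1).aemeasurable]
      simp_rw [ENNReal.tsum_mul_right]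
      have h2 : ∀ (u : unipDelta L e dV hdV dW hdW) (ν : unipDeltaRat L e dV hdV dW hdW), ‖Fq (qw ν) u‖ₑ =
          ‖f (weylDelta L e dV hdV dW hdW * ((ν : unipDelta L e dV hdV dW hdW) : HA L e dV hdV dW hdW) * ((u : HA L e dV hdV dW hdW) * h))‖ₑ := by
        intro u ν
        rw [hFq]
        dsimp only
        rw [hqw]
        dsimp only
        rw [apply_out_mk_wq_mul wq hwq hf ν]
      simp_rw [h2]
      rw [lintegral_weylDelta_orbit_unfold νN hβ hfc h]
      exact hfin2
    rw [show (∑' ν, J (qw ν)) = ∑' ν, ∫ u, g (qw ν) u ∂νN from rfl, ← integral_tsum (fun ν => hgm (qw ν)) hsum2,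
      ← integral_wt_smul_tsum_weylDelta_orbit νN hβ hfc h hfin2]
    refine integral_congr_ae (ae_of_all _ fun u => ?_)
    show (∑' ν, (β u).toReal • Fq (qw ν) u) = _
    rw [tsum_const_smul'' (β u).toReal]
    congr 1
    refine tsum_congr fun ν => ?_
    rw [hFq]
    dsimp only
    rw [hqw]
    dsimp only
    rw [apply_out_mk_wq_mul wq hwq hf ν]
  -- Step 3c: the remaining cosets, Fubini backwards
  have hE : ∑' q : ↥(({q₁} ∪ Set.range qw)ᶜ : Set (SiegelDeltaQuot L e dV hdV dW hdW)), J q =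
      ∫ u, (β u).toReal • (∑' q : ↥(({q₁} ∪ Set.range qw)ᶜ : Set (SiegelDeltaQuot L e dV hdV dW hdW)), Fq q u) ∂νN := by
    have hsum3 : ∑' q : ↥(({q₁} ∪ Set.range qw)ᶜ : Set (SiegelDeltaQuot L e dV hdV dW hdW)), ∫⁻ u, ‖g q u‖ₑ ∂νN ≠ ∞ :=
      ne_top_of_le_ne_top hsum (ENNReal.tsum_comp_le_tsum_of_injective Subtype.val_injective _)
    rw [show (∑' q : ↥(({q₁} ∪ Set.range qw)ᶜ : Set (SiegelDeltaQuot L e dV hdV dW hdW)), J q) =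
        ∑' q : ↥(({q₁} ∪ Set.range qw)ᶜ : Set (SiegelDeltaQuot L e dV hdV dW hdW)), ∫ u, g q u ∂νN from rfl,
      ← integral_tsum (f := fun (q : ↥(({q₁} ∪ Set.range qw)ᶜ : Set (SiegelDeltaQuot L e dV hdV dW hdW))) u => g q u)
        (fun q => hgm q) hsum3]
    refine integral_congr_ae (ae_of_all _ fun u => ?_)
    show (∑' q : ↥(({q₁} ∪ Set.range qw)ᶜ : Set (SiegelDeltaQuot L e dV hdV dW hdW)), (β u).toReal • Fq q u) = _
    rw [tsum_const_smul'' (β u).toReal]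
  rw [h1, hB, hC]
  -- (`rw [hD]` would make `kabstract` compare `tsum`s over different index types by unfolding the carriers — use `congrArg₂`)
  exact congrArg₂ (fun x y => (∫ u, (β u).toReal ∂νN) • f h + x + y) hD hE

end Main

end Summit.HodgeConjecture.HodgeConjecture.Cruxes.HLiu418.K2LiuConstantTermDelta

end
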